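import Literature.AlgebraicGeometry.Motives.HodgeLieWeightOneMinimalRaising
import HarnessLib

/-!
# Weight one: an ideal of `Lie Hg ⊗ ℂ` commuting with a raising operator of rank `r` has dimension `≤ r (r − 1) / 2`
# (the `Θ`-commutant ideal `𝔠` of the tree's `HodgeLieWeightOneThetaIdeal` is small; Moonen–Zarhin 1999 (2.3), Deligne I §3)

Family `hodge`, layer `Literature/AlgebraicGeometry/Motives`; THEOREMS ONLY (no definition, no named fact; D-0026).  Written for the
cell `pub-hodgeav-hg6` (LADDER-HodgeAV row 2, TABLE X row 1 `g6.I(1)`: brick N8 of the row-1 programme «`End⁰ = ℚ`, `g = 6` ⟹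
`Hg = Sp₁₂`», whose remaining crux after `HodgeLieWeightOneRankTwelveReduction` is a minimal raising tripotent of rank `r ∈ {2, 3, 4}`;
honest framing of that cell: HC / HC_AV / HC_CM NOT proved — unconditional Hodge–Lie linear algebra).

SETTING.  `H` effective polarized of weight `1` (`P = V^{1,0}`, `Q = V^{0,1}`, `Θ` the Hodge operator), `V_ℂ` irreducible under
`𝔥_ℂ = Lie Hg ⊗ ℂ` (e.g. `End_Hdg = ℚ`, `SymplecticTheta.eq_bot_or_top_of_stable`), and a splitting `𝔥_ℂ = 𝔰 + 𝔠` as produced by the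
tree's `exists_thetaIdeal_of_forall_endAlg_eq_smul` (N2): `𝔠 ⊆ 𝔥_ℂ` an `ad 𝔥_ℂ`-stable subspace commuting with `Θ`, every `Z ∈ 𝔥_ℂ`
of the form `s + z` with `z ∈ 𝔠` and `s` commuting with `𝔠`; and a raising operator `B ∈ 𝔥_ℂ` (`B P = 0`, `B V_ℂ ⊆ P`), `B ≠ 0`, of
rank `r`, commuting with `𝔠` (e.g. `B ∈ 𝔰₁`).

* **`WeightOneCommutant.finrank_le_card`** — `dim 𝔠 ≤ #{(i, j) : i < j < r} = r (r − 1) / 2`.  PROOF.  Choose `e₁, …, e_r ∈ Q` with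
  `B e_i` a basis of `U = range B`.  The linear map `Φ : 𝔠 → ℂ^{(i<j)}`, `Φ(c)_{ij} = ψ_ℂ(B c e_i, e_j)`, is injective: the form
  `(x, y) ↦ ψ_ℂ(B c x, y)` is alternating (`c B = B c`, `c` and `B` are `ψ_ℂ`-skew), so `Φ c = 0` gives `ψ_ℂ(B c e_i, e_j) = 0` for
  all `i, j`, whence `c (B e_i) ⊥ B Q = U`-preimages… precisely `ψ_ℂ(c B e_i, q) = −ψ_ℂ(c e_i, B q) = 0` for `q ∈ Q` (expand `B q` in
  the `B e_j`) and `ψ_ℂ(c B e_i, P) = 0` (`P` isotropic, `c B e_i ∈ P`), so `c` kills `U` by non-degeneracy; finally the elements of `𝔠`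
  killing `U` form an `ad 𝔥_ℂ`-stable subspace `I` (`[s + z, c'] = [z, c']` and `z U ⊆ U`), whose joint kernel is `𝔥_ℂ`-stable and
  contains `U ≠ 0`, hence is `V_ℂ`: `I = 0`, `c = 0`.
* **`WeightOneCommutant.finrank_le_six_of_finrank_range_le_four`** — `r ≤ 4 ⟹ dim 𝔠 ≤ 6` (the crux range `r ∈ {2, 3, 4}`: bounds
  `1, 3, 6`).  CONSEQUENCE for the cell (with N2's Jacobson clause «`𝔠 = 0` or `𝔠` contains an ideal of dimension `dim 𝔰₁`»): as soon
  as `dim 𝔰₁ > 6` — e.g. `𝔰₁ ∋ B, x, B̄, x̄, [B, B̄], [B, x̄], [x, B̄]` for a Peirce-`1` element `x` — the `Θ`-commutant ideal vanishes and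
  `Lie Hg ⊗ ℂ` is SIMPLE; this excludes the genuine complex configurations `𝔰𝔭₄ ⊕ 𝔰𝔬₃` (`r = 3`) and `𝔰𝔩₂ ⊕ 𝔰𝔬₆` (`r = 4`).

## References

* [MoonenZarhin1999LowDim] B. Moonen, Yu. Zarhin, *Hodge classes on abelian varieties of low dimension*, Math. Ann. 315 (1999),
  §2 (2.3)–(2.5), §3 (3.1).
* [Deligne1982HodgeCycles] P. Deligne, *Hodge cycles on abelian varieties*, LNM 900 (1982), I §3 (Prop. 3.4, 3.6, Example 3.7).
* [GoodmanWallachGTM255] R. Goodman, N. R. Wallach, GTM 255 (2009), §2.1.2, §4.1.1.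
-/

noncomputable section

open scoped TensorProduct

namespace Literature.AlgebraicGeometry.Motives

namespace HodgeStructure

universe u

variable {V : Type u} [AddCommGroup V] [Module ℚ V] [Module.Finite ℚ V] [HodgeTensorFacts.{u, u}] {n : ℤ}

set_option maxHeartbeats 1600000 in
/-- **An `ad`-stable subspace `𝔠 ⊆ 𝔥_ℂ` commuting with `Θ`, with a commuting supplement, and commuting with a non-zero raising operator
`B` of rank `r`, has `dim 𝔠 ≤ #{i < j < r}`** (`V_ℂ` irreducible under `𝔥_ℂ`): `c ↦ (ψ_ℂ(B c e_i, e_j))_{i<j}` is injective.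
[cite: MoonenZarhin1999LowDim, §2 (2.3)–(2.5)] [cite: Deligne1982HodgeCycles, I §3 Prop. 3.4, Prop. 3.6]
[cite: GoodmanWallachGTM255, §4.1.1] -/
theorem WeightOneCommutant.finrank_le_card (H : HodgeStructure V n) (ψ : H.Polarization) (hn : n = 1)
    (heff : H.IsEffective) {Θ : Module.End ℂ (ℂ ⊗[ℚ] V)} (hΘ : ∀ p, ∀ x ∈ H.piece p (n - p), Θ x = ((2 * p - n : ℤ) : ℂ) • x)
    (hirr : ∀ U : Submodule ℂ (ℂ ⊗[ℚ] V), (∀ Z ∈ H.hodgeLieC, ∀ u ∈ U, Z u ∈ U) → U = ⊥ ∨ U = ⊤)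
    {𝔠 : Submodule ℂ (Module.End ℂ (ℂ ⊗[ℚ] V))} (h𝔠 : 𝔠 ≤ H.hodgeLieC)
    (had : ∀ Z ∈ H.hodgeLieC, ∀ c ∈ 𝔠, Z * c - c * Z ∈ 𝔠)
    (hsplit : ∀ Z ∈ H.hodgeLieC, ∃ s z : Module.End ℂ (ℂ ⊗[ℚ] V), Z = s + z ∧ z ∈ 𝔠 ∧ ∀ c ∈ 𝔠, s * c = c * s)
    (hΘc : ∀ c ∈ 𝔠, Θ * c = c * Θ)
    {B : Module.End ℂ (ℂ ⊗[ℚ] V)} (hB : B ∈ H.hodgeLieC) (hB0 : B ≠ 0) (hBP : ∀ p ∈ H.piece 1 0, B p = 0)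
    (hBim : ∀ v, B v ∈ H.piece 1 0) (hcB : ∀ c ∈ 𝔠, c * B = B * c) {r : ℕ}
    (hr : Module.finrank ℂ (LinearMap.range B) = r) :
    Module.finrank ℂ 𝔠 ≤ Fintype.card {p : Fin r × Fin r // p.1 < p.2} := by
  classical
  subst hn
  obtain ⟨hPmem, hQmem, hΘ10, hΘ01, hΘΘ⟩ := UnitaryTheta.theta_facts H rfl heff hΘ
  have hTfix : ∀ x : ℂ ⊗[ℚ] V, Θ x = x → x ∈ H.piece 1 0 := fun x hx => by
    have h := hPmem x
    rwa [hx, ← two_smul ℂ x, smul_smul, inv_mul_cancel₀ (two_ne_zero' ℂ), one_smul] at h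
  set ω := ψ.form.baseChange ℂ with hω
  have hωalt : ∀ x y, ω x y = -ω y x := fun x y => by rw [hω, form_baseChange_swap_of_odd H odd_one ψ y x]
  have hωnd : ω.Nondegenerate := by rw [hω]; exact ψ.nondegenerate_baseChange
  have hBsk : ∀ x y, ω (B x) y = -ω x (B y) := fun x y => by rw [hω, formBaseChange_skew_of_mem_hodgeLieC ψ hB]
  have hΘC : Θ ∈ H.hodgeLieC := H.mem_hodgeLieC_of_forall_piece hΘ
  have hPP : ∀ p ∈ H.piece 1 0, ∀ p' ∈ H.piece 1 0, ω p p' = 0 := by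
    intro p hp p' hp'
    have h : ω (Θ p) p' = -ω p (Θ p') := by rw [hω, formBaseChange_skew_of_mem_hodgeLieC ψ hΘC]
    rw [hΘ10 p hp, hΘ10 p' hp'] at h
    have h2 : (2 : ℂ) * ω p p' = 0 := by linear_combination h
    exact (mul_eq_zero.1 h2).resolve_left (two_ne_zero' ℂ)
  -- a basis `B e_i` of `U = range B` with `e_i ∈ Q`
  let b := Module.finBasisOfFinrankEq ℂ (LinearMap.range B) hr
  have hpre : ∀ i, ∃ q ∈ H.piece 0 1, B q = (b i : ℂ ⊗[ℚ] V) := fun i => by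
    obtain ⟨v, hv⟩ := LinearMap.mem_range.1 (b i).2
    refine ⟨(2 : ℂ)⁻¹ • (v - Θ v), hQmem v, ?_⟩
    have hsum : (2 : ℂ)⁻¹ • (v + Θ v) + (2 : ℂ)⁻¹ • (v - Θ v) = v := by module
    rw [← hv]
    conv_rhs => rw [← hsum]
    rw [map_add, hBP _ (hPmem v), zero_add]
  choose e heQ heB using hpre
  -- the injective linear map `Φ`
  obtain ⟨Φ, hΦ⟩ : ∃ Φ : 𝔠 →ₗ[ℂ] ({p : Fin r × Fin r // p.1 < p.2} → ℂ),
      ∀ c p, Φ c p = ω (B ((c : Module.End ℂ (ℂ ⊗[ℚ] V)) (e p.1.1))) (e p.1.2) :=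
    ⟨{ toFun := fun c p => ω (B ((c : Module.End ℂ (ℂ ⊗[ℚ] V)) (e p.1.1))) (e p.1.2)
       map_add' := fun c c' => by
         funext p
         simp only [Submodule.coe_add, LinearMap.add_apply, map_add, Pi.add_apply]
       map_smul' := fun a c => by
         funext p
         simp only [Submodule.coe_smul, LinearMap.smul_apply, map_smul, Pi.smul_apply, smul_eq_mul, RingHom.id_apply] },
      fun c p => rfl⟩
  have hker : ∀ c : 𝔠, Φ c = 0 → c = 0 := by
    intro c hc
    have hcsk : ∀ x y, ω ((c : Module.End ℂ (ℂ ⊗[ℚ] V)) x) y = -ω x ((c : Module.End ℂ (ℂ ⊗[ℚ] V)) y) :=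
      fun x y => by rw [hω, formBaseChange_skew_of_mem_hodgeLieC ψ (h𝔠 c.2)]
    have hcBv : ∀ v, (c : Module.End ℂ (ℂ ⊗[ℚ] V)) (B v) = B ((c : Module.End ℂ (ℂ ⊗[ℚ] V)) v) := fun v => by
      rw [← Module.End.mul_apply, hcB _ c.2, Module.End.mul_apply]
    have halt : ∀ x y, ω (B ((c : Module.End ℂ (ℂ ⊗[ℚ] V)) x)) y = -ω (B ((c : Module.End ℂ (ℂ ⊗[ℚ] V)) y)) x :=
      fun x y =>
      calc ω (B ((c : Module.End ℂ (ℂ ⊗[ℚ] V)) x)) y = ω ((c : Module.End ℂ (ℂ ⊗[ℚ] V)) (B x)) y := by rw [hcBv]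
        _ = -ω (B x) ((c : Module.End ℂ (ℂ ⊗[ℚ] V)) y) := hcsk _ _
        _ = ω x (B ((c : Module.End ℂ (ℂ ⊗[ℚ] V)) y)) := by rw [hBsk x, neg_neg]
        _ = -ω (B ((c : Module.End ℂ (ℂ ⊗[ℚ] V)) y)) x := hωalt _ _
    have h0 : ∀ i j, ω (B ((c : Module.End ℂ (ℂ ⊗[ℚ] V)) (e i))) (e j) = 0 := by
      intro i j
      rcases lt_trichotomy i j with hij | rfl | hji
      · have h := congr_fun hc ⟨(i, j), hij⟩
        rwa [hΦ] at h
      · have h := halt (e i) (e i)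
        have h2 : (2 : ℂ) * ω (B ((c : Module.End ℂ (ℂ ⊗[ℚ] V)) (e i))) (e i) = 0 := by linear_combination h
        exact (mul_eq_zero.1 h2).resolve_left (two_ne_zero' ℂ)
      · rw [halt]
        have h := congr_fun hc ⟨(j, i), hji⟩
        rw [hΦ] at h
        change ω (B ((c : Module.End ℂ (ℂ ⊗[ℚ] V)) (e j))) (e i) = 0 at h
        rw [h, neg_zero]
    -- `c` kills every `B e_i`
    have hcu : ∀ i, (c : Module.End ℂ (ℂ ⊗[ℚ] V)) (B (e i)) = 0 := fun i => by
      refine hωnd.1 _ fun w => ?_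
      have hw : w = (2 : ℂ)⁻¹ • (w + Θ w) + (2 : ℂ)⁻¹ • (w - Θ w) := by module
      have hcuP : (c : Module.End ℂ (ℂ ⊗[ℚ] V)) (B (e i)) ∈ H.piece 1 0 := hTfix _ (by
        rw [← Module.End.mul_apply, hΘc _ c.2, Module.End.mul_apply, hΘ10 _ (hBim _)])
      rw [hw, map_add, hPP _ hcuP _ (hPmem w), zero_add, hcBv, hBsk]
      have hBq : B ((2 : ℂ)⁻¹ • (w - Θ w)) ∈ LinearMap.range B := LinearMap.mem_range_self B _
      have hexp : B ((2 : ℂ)⁻¹ • (w - Θ w)) = ∑ j, (b.repr ⟨_, hBq⟩ j) • B (e j) := by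
        have h := congrArg Subtype.val (b.sum_repr ⟨_, hBq⟩)
        simp only [Submodule.coe_sum, Submodule.coe_smul, ← heB] at h
        exact h.symm
      rw [hexp, map_sum, Finset.sum_eq_zero fun j _ => ?_, neg_zero]
      have h1 : ω ((c : Module.End ℂ (ℂ ⊗[ℚ] V)) (e i)) (B (e j)) = 0 := by
        have h' := hBsk ((c : Module.End ℂ (ℂ ⊗[ℚ] V)) (e i)) (e j)
        rw [h0 i j] at h'
        linear_combination h'
      rw [map_smul, smul_eq_mul, h1, mul_zero]
    have hcU : ∀ u ∈ LinearMap.range B, (c : Module.End ℂ (ℂ ⊗[ℚ] V)) u = 0 := fun u hu => by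
      have h := congrArg Subtype.val (b.sum_repr ⟨u, hu⟩)
      rw [Submodule.coe_sum] at h
      change ∑ j, ((b.repr ⟨u, hu⟩ j • b j : LinearMap.range B) : ℂ ⊗[ℚ] V) = u at h
      rw [← h, map_sum, Finset.sum_eq_zero fun j _ => ?_]
      rw [Submodule.coe_smul, ← heB, map_smul, hcu, smul_zero]
    -- the elements of `𝔠` killing `U` form an `ad 𝔥_ℂ`-stable subspace, whose joint kernel is `𝔥_ℂ`-stable and contains `U`
    have hIad : ∀ Z ∈ H.hodgeLieC, ∀ c' ∈ 𝔠, (∀ u ∈ LinearMap.range B, c' u = 0) →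
        ∀ u ∈ LinearMap.range B, (Z * c' - c' * Z) u = 0 := by
      intro Z hZ c' hc' hc'U u hu
      obtain ⟨s, z, rfl, hz, hs⟩ := hsplit Z hZ
      obtain ⟨v, rfl⟩ := LinearMap.mem_range.1 hu
      have h1 : c' (s (B v)) = 0 := by
        rw [← Module.End.mul_apply, ← hs c' hc', Module.End.mul_apply, hc'U _ (LinearMap.mem_range_self B v), map_zero]
      have h2 : c' (z (B v)) = 0 := by
        rw [← Module.End.mul_apply z B v, hcB z hz, Module.End.mul_apply]
        exact hc'U _ (LinearMap.mem_range_self B _)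
      rw [LinearMap.sub_apply, Module.End.mul_apply, Module.End.mul_apply, hc'U _ (LinearMap.mem_range_self B v), map_zero,
        zero_sub, LinearMap.add_apply, map_add, h1, h2, add_zero, neg_zero]
    obtain ⟨VI, hVI⟩ : ∃ VI : Submodule ℂ (ℂ ⊗[ℚ] V),
        ∀ v, v ∈ VI ↔ ∀ c' ∈ 𝔠, (∀ u ∈ LinearMap.range B, c' u = 0) → c' v = 0 := by
      refine ⟨{ carrier := {v | ∀ c' ∈ 𝔠, (∀ u ∈ LinearMap.range B, c' u = 0) → c' v = 0}
                add_mem' := fun hx hy c' hc' hU => by rw [map_add, hx c' hc' hU, hy c' hc' hU, add_zero]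
                zero_mem' := fun c' _ _ => map_zero c'
                smul_mem' := fun a x hx c' hc' hU => by
                  change c' (a • x) = 0
                  rw [map_smul, hx c' hc' hU, smul_zero] }, fun v => Iff.rfl⟩
    have hVIst : ∀ Z ∈ H.hodgeLieC, ∀ v ∈ VI, Z v ∈ VI := by
      intro Z hZ v hv
      rw [hVI] at hv ⊢
      intro c' hc' hU
      have h2 := hv _ (had Z hZ c' hc') (hIad Z hZ c' hc' hU)
      rw [LinearMap.sub_apply, Module.End.mul_apply, Module.End.mul_apply, hv c' hc' hU, map_zero, zero_sub,
        neg_eq_zero] at h2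
      exact h2
    have hVItop : VI = ⊤ := by
      rcases hirr VI hVIst with h | h
      · exfalso
        refine hB0 (LinearMap.ext fun v => ?_)
        have hBv : B v ∈ VI := (hVI _).2 fun c' _ hU => hU _ (LinearMap.mem_range_self B v)
        rw [h, Submodule.mem_bot] at hBv
        rw [hBv, LinearMap.zero_apply]
      · exact h
    refine Subtype.ext (LinearMap.ext fun v => ?_)
    have hv : v ∈ VI := by rw [hVItop]; exact Submodule.mem_top
    exact (hVI v).1 hv _ c.2 hcU
  have hΦinj : Function.Injective Φ := fun c c' h =>
    sub_eq_zero.1 (hker (c - c') (by rw [show Φ (c - c') = Φ c - Φ c' from map_sub Φ c c', h, sub_self]))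
  calc Module.finrank ℂ 𝔠 ≤ Module.finrank ℂ ({p : Fin r × Fin r // p.1 < p.2} → ℂ) :=
      LinearMap.finrank_le_finrank_of_injective hΦinj
    _ = Fintype.card {p : Fin r × Fin r // p.1 < p.2} := Module.finrank_fintype_fun_eq_card ℂ

/-- **`rank B ≤ 4 ⟹ dim 𝔠 ≤ 6`** (the crux range of the cell: for `r = 2, 3, 4` the bound `#{i < j < r}` is `1, 3, 6`).
[cite: MoonenZarhin1999LowDim, §2 (2.3)–(2.5)] [cite: Deligne1982HodgeCycles, I §3 Prop. 3.4, Prop. 3.6] -/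
theorem WeightOneCommutant.finrank_le_six_of_finrank_range_le_four (H : HodgeStructure V n) (ψ : H.Polarization) (hn : n = 1)
    (heff : H.IsEffective) {Θ : Module.End ℂ (ℂ ⊗[ℚ] V)} (hΘ : ∀ p, ∀ x ∈ H.piece p (n - p), Θ x = ((2 * p - n : ℤ) : ℂ) • x)
    (hirr : ∀ U : Submodule ℂ (ℂ ⊗[ℚ] V), (∀ Z ∈ H.hodgeLieC, ∀ u ∈ U, Z u ∈ U) → U = ⊥ ∨ U = ⊤)
    {𝔠 : Submodule ℂ (Module.End ℂ (ℂ ⊗[ℚ] V))} (h𝔠 : 𝔠 ≤ H.hodgeLieC)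
    (had : ∀ Z ∈ H.hodgeLieC, ∀ c ∈ 𝔠, Z * c - c * Z ∈ 𝔠)
    (hsplit : ∀ Z ∈ H.hodgeLieC, ∃ s z : Module.End ℂ (ℂ ⊗[ℚ] V), Z = s + z ∧ z ∈ 𝔠 ∧ ∀ c ∈ 𝔠, s * c = c * s)
    (hΘc : ∀ c ∈ 𝔠, Θ * c = c * Θ)
    {B : Module.End ℂ (ℂ ⊗[ℚ] V)} (hB : B ∈ H.hodgeLieC) (hB0 : B ≠ 0) (hBP : ∀ p ∈ H.piece 1 0, B p = 0)
    (hBim : ∀ v, B v ∈ H.piece 1 0) (hcB : ∀ c ∈ 𝔠, c * B = B * c)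
    (hr4 : Module.finrank ℂ (LinearMap.range B) ≤ 4) : Module.finrank ℂ 𝔠 ≤ 6 := by
  obtain ⟨r, hr⟩ : ∃ r, Module.finrank ℂ (LinearMap.range B) = r := ⟨_, rfl⟩
  have h := WeightOneCommutant.finrank_le_card H ψ hn heff hΘ hirr h𝔠 had hsplit hΘc hB hB0 hBP hBim hcB hr
  rw [hr] at hr4
  interval_cases r
  · exact h.trans (by decide)
  · exact h.trans (by decide)
  · exact h.trans (by decide)
  · exact h.trans (by decide)
  · exact h.trans (by decide)

end HodgeStructure

end Literature.AlgebraicGeometry.Motives
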